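import Summits.FinalStateConjecture.FinalStateConjecture.Theorems.ClusterCompletenessOmegaLimitMultiKerrT2Defs
import HarnessLib

/-!
# Crux `LaminatedThreshold` (stmt-FinalStateConjecture-16893) — the CONTINUITY clause is load-bearing: without it the crux degenerates

Negative support lemma (tightness / load-bearing analysis) for the crux of the REFUTATION route
`LaminatedThreshold` (refuter, cdisprove cycle 1). The crux asserts `∃ X d⋆ Φ K`: `d⋆` admissible and
exceptional, `Φ d⋆ ∈ K` two-sidedly accumulated by `K`, and along every local family `F` through `d⋆`
(jointly smooth, `F 0 = d⋆`, admissible members, agreeing with `d⋆` off one compact set) there is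
`δ > 0` with (i) `Φ ∘ F` CONTINUOUS on the `δ`-ball and (ii) `Φ (F c) ∈ K ⇒ F c` exceptional there.

`withoutContinuity_iff_exists_exceptional`: drop clause (i) and keep everything else verbatim — the
resulting statement is EQUIVALENT to the bare existence of an admissible exceptional datum. The
non-trivial direction takes `Φ` = the indicator of goodness and `K = (−1, 1)`: then `0 = Φ d⋆ ∈ K` is a
two-sided accumulation point of `K` and `Φ (F c) ∈ K ↔ F c` exceptional, so saturation is a tautology.
Hence everything the crux says beyond "some admissible datum is exceptional" — in particular the
two-sided accumulation of exceptional members along every local family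
(`exceptional_accumulate_of_laminatedThreshold`) that the route's assembly consumes — enters through the
continuity clause; a proof of the crux must produce a functional that is curve-wise continuous AND
whose `K`-levels are exceptional, and a disproof may not ignore continuity. "Good" is the summit's
per-datum property `(∃ MGHD) ∧ ∀ MGHD, SettlesT2` (`ClusterCompleteness.SettlesT2`, `Iff.rfl` with the
route file's block; both sides below inline the crux's binders verbatim, so the left side `δ`-unfolds to
the crux with clause (i) deleted). Pure logic; no definitions, no named facts.
-/

-- every `Summit.FinalStateConjecture.FinalStateConjecture.…` name repeats the summit = sub-problem segment (D-0017 layout)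
set_option linter.dupNamespace false

noncomputable section

open Set Filter Metric
open scoped Manifold ContDiff Topology

namespace Summit.FinalStateConjecture.FinalStateConjecture.Theorems.LaminatedThreshold.Negative

open Literature.Geometry.Lorentzian
open Summit.FinalStateConjecture.FinalStateConjecture.Theorems.ClusterCompleteness (SettlesT2)

/-- **Without the continuity clause the crux `LaminatedThreshold` degenerates** to the bare existence
of an admissible exceptional datum: (→) forget `Φ`, `K` and the family clause; (←) `Φ` = indicator of
goodness (`1` on good data, `0` on exceptional data), `K = (−1, 1)`, `δ = 1` — `Φ d⋆ = 0 ∈ K`, `K`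
meets `(−ε, 0)` and `(0, ε)` at `∓ min ε 1 / 2`, and `Φ (F c) ∈ (−1, 1)` forces `Φ (F c) ≠ 1`, i.e.
`F c` exceptional. [folklore] -/
theorem withoutContinuity_iff_exists_exceptional :
    (∃ (X : Type) (_ : TopologicalSpace X) (_ : ChartedSpace E3 X) (_ : IsManifold (𝓡 3) ∞ X)
      (_ : T2Space X) (_ : SecondCountableTopology X) (_ : ConnectedSpace X)
      (dstar : InitialDataSet (𝓡 3) X) (Φ : InitialDataSet (𝓡 3) X → ℝ) (K : Set ℝ),
      dstar ∈ admissibleVacuumData X ∧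
      ¬ ((∃ 𝒟 : VacuumCauchyDevelopment dstar, 𝒟.IsMaximal) ∧
          ∀ 𝒟 : VacuumCauchyDevelopment dstar, 𝒟.IsMaximal → SettlesT2 𝒟) ∧
      Φ dstar ∈ K ∧
      (∀ ε : ℝ, 0 < ε →
        (K ∩ Set.Ioo (Φ dstar - ε) (Φ dstar)).Nonempty ∧ (K ∩ Set.Ioo (Φ dstar) (Φ dstar + ε)).Nonempty) ∧
      ∀ F : EuclideanSpace ℝ (Fin 1) → InitialDataSet (𝓡 3) X,
        InitialDataSet.IsSmoothDataFamily 1 F → F 0 = dstar → (∀ c, F c ∈ admissibleVacuumData X) →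
        (∃ C : Set X, IsCompact C ∧
          ∀ c, ∀ x ∉ C, (F c).h.inner x = dstar.h.inner x ∧ (F c).k x = dstar.k x) →
        ∃ δ : ℝ, 0 < δ ∧
          ∀ c ∈ Metric.ball (0 : EuclideanSpace ℝ (Fin 1)) δ, Φ (F c) ∈ K →
            ¬ ((∃ 𝒟 : VacuumCauchyDevelopment (F c), 𝒟.IsMaximal) ∧
                ∀ 𝒟 : VacuumCauchyDevelopment (F c), 𝒟.IsMaximal → SettlesT2 𝒟)) ↔
    ∃ (X : Type) (_ : TopologicalSpace X) (_ : ChartedSpace E3 X) (_ : IsManifold (𝓡 3) ∞ X)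
      (_ : T2Space X) (_ : SecondCountableTopology X) (_ : ConnectedSpace X)
      (dstar : InitialDataSet (𝓡 3) X),
      dstar ∈ admissibleVacuumData X ∧
      ¬ ((∃ 𝒟 : VacuumCauchyDevelopment dstar, 𝒟.IsMaximal) ∧
          ∀ 𝒟 : VacuumCauchyDevelopment dstar, 𝒟.IsMaximal → SettlesT2 𝒟) := by
  constructor
  · rintro ⟨X, i₁, i₂, i₃, i₄, i₅, i₆, dstar, Φ, K, hadm, hbad, -, -, -⟩
    exact ⟨X, i₁, i₂, i₃, i₄, i₅, i₆, dstar, hadm, hbad⟩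
  · rintro ⟨X, i₁, i₂, i₃, i₄, i₅, i₆, dstar, hadm, hbad⟩
    classical
    -- `Φ` = indicator of goodness, `K = (−1, 1)`
    let good : InitialDataSet (𝓡 3) X → Prop := fun D ↦
      (∃ 𝒟 : VacuumCauchyDevelopment D, 𝒟.IsMaximal) ∧
        ∀ 𝒟 : VacuumCauchyDevelopment D, 𝒟.IsMaximal → SettlesT2 𝒟
    let Φ : InitialDataSet (𝓡 3) X → ℝ := fun D ↦ if good D then 1 else 0
    have hΦ0 : Φ dstar = 0 := by simp [Φ, good, hbad]
    refine ⟨X, i₁, i₂, i₃, i₄, i₅, i₆, dstar, Φ, Set.Ioo (-1) 1, hadm, hbad, ?_, ?_, ?_⟩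
    · rw [hΦ0]; exact ⟨by norm_num, by norm_num⟩
    · intro ε hε
      rw [hΦ0]
      have h1 : 0 < min ε 1 := lt_min hε one_pos
      have h2 : min ε 1 ≤ 1 := min_le_right _ _
      have h3 : min ε 1 ≤ ε := min_le_left _ _
      refine ⟨⟨-(min ε 1 / 2), ?_, ?_⟩, ⟨min ε 1 / 2, ?_, ?_⟩⟩
      · constructor <;> linarith
      · constructor <;> linarith
      · constructor <;> linarith
      · constructor <;> linarith
    · intro F _ _ _ _
      refine ⟨1, one_pos, fun c _ hcK hgood ↦ ?_⟩
      have hΦ1 : Φ (F c) = 1 := if_pos hgood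
      rw [hΦ1] at hcK
      exact lt_irrefl _ hcK.2

end Summit.FinalStateConjecture.FinalStateConjecture.Theorems.LaminatedThreshold.Negative

end
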